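import Literature.MathematicalPhysics.QuantumFieldTheory.Balaban1983to89.Beta.PlaquetteVertex2Polar
import Literature.MathematicalPhysics.QuantumFieldTheory.Balaban1983to89.Beta.ColourTraceWeights

/-!
# The fluctuation-colour trace of the polarised `(2,2)` plaquette kernel: `Σ_a K22(i,a; j,a; k,c; l,d) = [c = d]·w22(N; i,j,k,l)`
# in Bałaban's letters, with the explicit position table `w22`

HONEST FRAMING (cell `pub-balaban`, β sub-cell, lineage an3; verbatim): discharging `BetaPertH` makes Bałaban's UV stability
UNCONDITIONAL — a real constructive-QFT result; it is NOT the continuum limit and NOT the Clay problem.  This file discharges NOTHING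
of `BetaPertH`: it is finite colour algebra — the contraction, over the fluctuation colour index, of the eight-index table `K22` of
`Beta.PlaquetteVertex2Polar` in the concrete letters of the cell (`𝔸 = Mat_N(ℂ)`, `τ = rntr = N⁻¹·Re Tr`, anti-Hermitian generators
`t_c = i·τ_c` of a complete tr-orthonormal family), using the colour-trace closed forms of `Beta.ColourTraceWeights` §9 (lineage lit1,
v1.3) BY NAME.  ABSOLUTE RULE of the cell: no internally minted statement enters as a cited fact; every declaration below is a
definition or is kernel-proved here from the two imports; NOTHING is cited.  The manuscripts under audit are not citable for their
disputed steps and are not cited here.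

## Setting

`τ : C → Matrix (Fin N) (Fin N) ℂ` a generator family with `ColourTrace.Complete τ` (Fierz completeness, traceless convention (C1)) and
`ColourTrace.TrOrthonormal τ` (`Tr τ_c τ_d = N·δ_cd`, convention (C2)), `N ≠ 0`; letters `PlaquetteVertex.gen τ c = I • τ c`; the real
functional `PlaquetteVertex.rntr = N⁻¹·Re Tr` (tracial: `rntr_comm`).  Mathlib's `Matrix.linftyOpNormedRing/Algebra` are enabled as LOCAL
instances only to type the norm-generic definitions of the imports over `Mat_N(ℂ)`; every statement is norm-free algebra.

## What is proved

§1 THE POSITION TABLE.  `wSym N i j k l := N²(inc_{jk} − inc_{ik})(inc_{jl} − ½ s_l) + ½(N² − 1)·qq_{kl}`, `wPair N i j k l := N²(inc_{ik} − inc_{jk}) s_l`,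
**`w22 N i j k l := s_i s_j (wSym + [i<j]·wPair)`** — explicit reals built from the tables `inc`, `qq`, `sgn` of the imports; the
`N`-dependence is `N²·(…) + (N² − 1)·(…)` (`w22_eq_sq_add`); position-diagonal contraction **`sum_w22_diag : Σ_i w22 N i i k l = (N² − 1)·(2·qq k l)`**
(the fluctuation-diagonal part of the traced vertex is `(N² − 1)` times the scalar-slot table — the `quadB` word).

§2 PER-WORD COLOUR TRACES (all `× [c = d]`, at `rntr`-level): seagull `Σ_a rntr([t_c,t_a][t_d,t_a]) = −2N²` (lit1 (W1)); mixed
`Σ_a rntr(t_a[t_c,t_a]t_d) = −N²`, `Σ_a rntr([t_c,t_a]t_a t_d) = N²` (lit1 (W4)); transport `Σ_a rntr(t_a t_c [t_d,t_a]) = N²` (from (W4) by ONE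
cyclic rotation of `rntr`); the polarised accumulated-commutator word is invisible TERMWISE, `rntr(A Q A) = rntr(A A Q)`
(`rntr_sandwich`, cyclicity only); scalar slot `Σ_a rntr(t_a t_a (t_c t_d)) = N² − 1` (lit1 (W3)).

§3 THE TRACED KERNEL.  **`sum_pSym_diag`**, **`sum_pPair_diag`** and the headline

  **`sum_K22_diag : Σ_a K22 rntr (gen τ) i j k l a a c d = if c = d then w22 N i j k l else 0`**

— the fluctuation-colour trace of the `(2,2)` plaquette kernel is DIAGONAL in the two background colours with the explicit position
weight `w22`.  §4 COLOUR-BLIND TRACED FORM at a background in coordinates `B = field (gen τ) u`: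

  **`sum_M22_field_diag : Σ_a M22 rntr (gen τ) e (field (gen τ) u) x μ ν i j a a = Σ_k Σ_l (Σ_c u_k(c) u_l(c)) · w22 N i j k l`**

(`u_k(c) = cv e u x μ ν k c`): traced over the fluctuation colour, the `(2,2)` vertex of one plaquette sees the background ONLY through
the colour inner products `u_k · u_l` of its coordinates at the two background positions, weighted by `w22` — the finite datum a
one-loop contraction against a colour-blind fluctuation covariance consumes (the contraction itself, any covariance, any value of a
β-function coefficient are NOT in this file).

Gloss.  The six per-word traces and the tables were cross-checked beforehand numerically (Pauli `N = 2` exactly, scaled Gell-Mann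
`N = 3` to `1e−15`; design record of the lineage, not an input).  NOT PROVED HERE, NOT CLAIMED: any propagator / covariance
contraction over positions, the offset re-indexing into `stencilIns` data, the symmetric one-matrix operator form, any value or bound,
gauge fixing/averaging, anything of `BetaPertH`, UV stability, the continuum limit or the Clay problem.  GAPS record C-beta-an3-32
(HOME/GAPS.md of the cell).  All tags [folklore].
-/

noncomputable section

namespace Literature.MathematicalPhysics.QuantumFieldTheory.Balaban1983to89.Beta.PlaquetteVertex2Trace

open Finset
open scoped BigOperators
open Literature.MathematicalPhysics.QuantumFieldTheory.Balaban1983to89.Beta.ColourTrace (Complete TrOrthonormal)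
open Literature.MathematicalPhysics.QuantumFieldTheory.Balaban1983to89.Beta.ColourTraceWeights
open Literature.MathematicalPhysics.QuantumFieldTheory.Balaban1983to89.Beta.PlaquetteVertex (rntr rntr_apply rntr_comm gen field)
open Literature.MathematicalPhysics.QuantumFieldTheory.Balaban1983to89.Beta.SpinTable (br)
open Literature.MathematicalPhysics.QuantumFieldTheory.Balaban1983to89.Beta.PlaquetteVertex2Coords (sgn cv M22)
open Literature.MathematicalPhysics.QuantumFieldTheory.Balaban1983to89.Beta.PlaquetteVertex2Polar

/-! ## §1 The position table `w22` -/

section Table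

/-- symmetric-block weight: `wSym N i j k l := N²(inc_{jk} − inc_{ik})(inc_{jl} − ½ s_l) + ½(N² − 1)·qq_{kl}`. [folklore] -/
def wSym (N : ℕ) (i j k l : Fin 4) : ℝ :=
  (N : ℝ) ^ 2 * (inc j k - inc i k) * (inc j l - 2⁻¹ * sgn l) + 2⁻¹ * ((N : ℝ) ^ 2 - 1) * qq k l

/-- pair-block weight: `wPair N i j k l := N²(inc_{ik} − inc_{jk}) s_l`. [folklore] -/
def wPair (N : ℕ) (i j k l : Fin 4) : ℝ := (N : ℝ) ^ 2 * (inc i k - inc j k) * sgn l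

/-- **THE POSITION TABLE OF THE TRACED `(2,2)` KERNEL**: `w22 N i j k l := s_i s_j (wSym + [i<j]·wPair)`. [folklore] -/
def w22 (N : ℕ) (i j k l : Fin 4) : ℝ :=
  sgn i * sgn j * (wSym N i j k l + if i < j then wPair N i j k l else 0)

/-- THE `N`-STRUCTURE: `w22 = N²·A + (N² − 1)·B` with the `N`-free tables
`A = s_i s_j ((inc_{jk} − inc_{ik})(inc_{jl} − ½ s_l) + [i<j](inc_{ik} − inc_{jk}) s_l)`, `B = s_i s_j · ½ qq_{kl}`. [folklore] -/
theorem w22_eq_sq_add (N : ℕ) (i j k l : Fin 4) : w22 N i j k l =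
    (N : ℝ) ^ 2 * (sgn i * sgn j * ((inc j k - inc i k) * (inc j l - 2⁻¹ * sgn l)
      + if i < j then (inc i k - inc j k) * sgn l else 0))
    + ((N : ℝ) ^ 2 - 1) * (sgn i * sgn j * (2⁻¹ * qq k l)) := by
  unfold w22 wSym wPair
  split_ifs <;> ring

/-- **POSITION-DIAGONAL CONTRACTION**: `Σ_i w22 N i i k l = (N² − 1)·(2·qq k l)` — the fluctuation-diagonal part of the traced vertex is
`(N² − 1)` times the scalar-slot (`quadB`) table. [folklore] -/
theorem sum_w22_diag (N : ℕ) (k l : Fin 4) : ∑ i, w22 N i i k l = ((N : ℝ) ^ 2 - 1) * (2 * qq k l) := by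
  simp only [w22, wSym, wPair, lt_self_iff_false, if_false, add_zero, sub_self, mul_zero, zero_mul, zero_add, Fin.sum_univ_four]
  fin_cases k <;> fin_cases l <;> simp [qq, sgn] <;> ring

/-- the pair weight vanishes on the position diagonal `i = j`. [folklore] -/
theorem wPair_diag (N : ℕ) (i k l : Fin 4) : wPair N i i k l = 0 := by
  simp [wPair]

end Table

/-! ## §2 Per-word colour traces in Bałaban's letters -/

section Words

-- Mathlib's `L¹–L^∞` operator norm on square matrices is a `def`, not a global instance; enabled LOCALLY (as in `Beta.PlaquetteVertex`
-- §4) only to type the norm-generic definitions `br`, `pSym`, `pPair`, `m22`, `K22`, `M22`, `field` of the imports over `Mat_N(ℂ)`.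
attribute [local instance] Matrix.linftyOpNormedRing Matrix.linftyOpNormedAlgebra

variable {N : ℕ} {C : Type*} [Fintype C] [DecidableEq C]

omit [DecidableEq C] in
/-- a colour sum of `rntr`-values is `N⁻¹·Re` of the summed complex trace. [folklore] -/
theorem sum_rntr_eq (W : C → Matrix (Fin N) (Fin N) ℂ) : ∑ a, rntr (W a) = (N : ℝ)⁻¹ * (∑ a, (W a).trace).re := by
  simp only [rntr_apply, ← Finset.mul_sum, Complex.re_sum]

omit [Fintype C] [DecidableEq C] in
/-- THE POLARISED ACCUMULATED-COMMUTATOR WORD IS INVISIBLE TO THE TRACE, TERMWISE: `rntr(A Q A) = rntr(A A Q)` (cyclicity only), so the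
`c`-accumulator word `rntr(t_a (YY′) t_a) − rntr(t_a t_a (YY′))` of `pSym` vanishes letter by letter. [folklore] -/
theorem rntr_sandwich (A Q : Matrix (Fin N) (Fin N) ℂ) : rntr (A * Q * A) = rntr (A * A * Q) := by
  rw [rntr_comm (A * Q) A, ← mul_assoc]

omit [DecidableEq C] in
/-- (W2″) summed form: `Σ_a rntr(t_a Q t_a) = Σ_a rntr(t_a t_a Q)` (no hypothesis on the family). [folklore] -/
theorem sum_rntr_sandwich (t : C → Matrix (Fin N) (Fin N) ℂ) (Q : Matrix (Fin N) (Fin N) ℂ) :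
    ∑ a, rntr (t a * Q * t a) = ∑ a, rntr (t a * t a * Q) :=
  Finset.sum_congr rfl fun a _ => rntr_sandwich (t a) Q

omit [Fintype C] in
/-- `N⁻¹` against a `[c = d]`-supported value. [folklore] -/
theorem inv_mul_ite (c d : C) (x : ℝ) : (N : ℝ)⁻¹ * (if c = d then x else 0) = if c = d then (N : ℝ)⁻¹ * x else 0 := by
  split_ifs <;> simp

/-- (W1) SEAGULL: `Σ_a rntr([t_c,t_a][t_d,t_a]) = −[c = d]·2N²`. [folklore] -/
theorem sum_rntr_seagull {τ : C → Matrix (Fin N) (Fin N) ℂ} (hτ : Complete τ) (ho : TrOrthonormal τ) (hN : N ≠ 0) (c d : C) :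
    ∑ a, rntr (br (gen τ c) (gen τ a) * br (gen τ d) (gen τ a)) = if c = d then -(2 * (N : ℝ) ^ 2) else 0 := by
  simp only [sum_rntr_eq, gen, br]
  rw [sum_trace_letter4_comm_mul_comm_re hτ ho hN, inv_mul_ite]
  have hN' : (N : ℝ) ≠ 0 := Nat.cast_ne_zero.mpr hN
  split_ifs
  · field_simp
  · rfl

/-- (W4, first word) `Σ_a rntr(t_a [t_c,t_a] t_d) = −[c = d]·N²`. [folklore] -/
theorem sum_rntr_mul_br_mul {τ : C → Matrix (Fin N) (Fin N) ℂ} (hτ : Complete τ) (ho : TrOrthonormal τ) (hN : N ≠ 0) (c d : C) :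
    ∑ a, rntr (gen τ a * br (gen τ c) (gen τ a) * gen τ d) = if c = d then -((N : ℝ) ^ 2) else 0 := by
  simp only [sum_rntr_eq, gen, br]
  rw [sum_trace_letter4_mul_comm_mul_re hτ ho hN, inv_mul_ite]
  have hN' : (N : ℝ) ≠ 0 := Nat.cast_ne_zero.mpr hN
  split_ifs
  · field_simp
  · rfl

/-- (W4, second word) `Σ_a rntr([t_c,t_a] t_a t_d) = [c = d]·N²`. [folklore] -/
theorem sum_rntr_br_mul_mul {τ : C → Matrix (Fin N) (Fin N) ℂ} (hτ : Complete τ) (ho : TrOrthonormal τ) (hN : N ≠ 0) (c d : C) :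
    ∑ a, rntr (br (gen τ c) (gen τ a) * gen τ a * gen τ d) = if c = d then (N : ℝ) ^ 2 else 0 := by
  simp only [sum_rntr_eq, gen, br]
  rw [sum_trace_letter4_comm_mul_mul_re hτ ho hN, inv_mul_ite]
  have hN' : (N : ℝ) ≠ 0 := Nat.cast_ne_zero.mpr hN
  split_ifs
  · field_simp
  · rfl

/-- (W2′) SECOND-ORDER TRANSPORT WORD: `Σ_a rntr(t_a t_c [t_d,t_a]) = [c = d]·N²` — ONE cyclic rotation of `rntr` turns it into the second
(W4) word with the background letters exchanged. [folklore] -/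
theorem sum_rntr_mul_mul_br {τ : C → Matrix (Fin N) (Fin N) ℂ} (hτ : Complete τ) (ho : TrOrthonormal τ) (hN : N ≠ 0) (c d : C) :
    ∑ a, rntr (gen τ a * gen τ c * br (gen τ d) (gen τ a)) = if c = d then (N : ℝ) ^ 2 else 0 := by
  have h : ∀ a, rntr (gen τ a * gen τ c * br (gen τ d) (gen τ a)) = rntr (br (gen τ d) (gen τ a) * gen τ a * gen τ c) := by
    intro a
    rw [rntr_comm (gen τ a * gen τ c), ← mul_assoc]
  simp only [h, sum_rntr_br_mul_mul hτ ho hN d c, eq_comm]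

/-- (W3) SCALAR SLOT: `Σ_a rntr(t_a t_a (t_c t_d)) = [c = d]·(N² − 1)`. [folklore] -/
theorem sum_rntr_sq_mul {τ : C → Matrix (Fin N) (Fin N) ℂ} (hτ : Complete τ) (ho : TrOrthonormal τ) (hN : N ≠ 0) (c d : C) :
    ∑ a, rntr (gen τ a * gen τ a * (gen τ c * gen τ d)) = if c = d then (N : ℝ) ^ 2 - 1 else 0 := by
  simp only [sum_rntr_eq, gen, ← mul_assoc]
  rw [sum_trace_letter4_sq_mul_re hτ ho, inv_mul_ite]
  have hN' : (N : ℝ) ≠ 0 := Nat.cast_ne_zero.mpr hN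
  split_ifs
  · field_simp
  · rfl

end Words

/-! ## §3 The traced kernel -/

section Traced

attribute [local instance] Matrix.linftyOpNormedRing Matrix.linftyOpNormedAlgebra

variable {N : ℕ} {C : Type*} [Fintype C] [DecidableEq C]

/-- **THE TRACED SYMMETRIC BLOCK**: `Σ_a pSym rntr (gen τ) i j k l (t_c) (t_d) a a = [c = d]·wSym N i j k l`. [folklore] -/
theorem sum_pSym_diag {τ : C → Matrix (Fin N) (Fin N) ℂ} (hτ : Complete τ) (ho : TrOrthonormal τ) (hN : N ≠ 0)
    (i j k l : Fin 4) (c d : C) :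
    ∑ a, pSym rntr (gen τ) i j k l (gen τ c) (gen τ d) a a = if c = d then wSym N i j k l else 0 := by
  simp only [pSym, Finset.sum_add_distrib, Finset.sum_sub_distrib, ← Finset.mul_sum, sum_rntr_seagull hτ ho hN,
    sum_rntr_mul_mul_br hτ ho hN, sum_rntr_mul_br_mul hτ ho hN, sum_rntr_sandwich, sum_rntr_sq_mul hτ ho hN,
    sum_rntr_br_mul_mul hτ ho hN]
  unfold wSym
  split_ifs <;> ring

/-- **THE TRACED PAIR BLOCK**: `Σ_a pPair rntr (gen τ) i j k l (t_c) (t_d) a a = [c = d]·wPair N i j k l`. [folklore] -/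
theorem sum_pPair_diag {τ : C → Matrix (Fin N) (Fin N) ℂ} (hτ : Complete τ) (ho : TrOrthonormal τ) (hN : N ≠ 0)
    (i j k l : Fin 4) (c d : C) :
    ∑ a, pPair rntr (gen τ) i j k l (gen τ c) (gen τ d) a a = if c = d then wPair N i j k l else 0 := by
  simp only [pPair, sub_self, mul_zero, zero_add, Finset.sum_add_distrib, Finset.sum_sub_distrib, ← Finset.mul_sum,
    sum_rntr_mul_br_mul hτ ho hN, sum_rntr_br_mul_mul hτ ho hN]
  unfold wPair
  split_ifs <;> ring

/-- **THE FLUCTUATION-COLOUR TRACE OF THE `(2,2)` PLAQUETTE KERNEL**: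
`Σ_a K22 rntr (gen τ) i j k l a a c d = [c = d]·w22 N i j k l` — diagonal in the background colours, with the explicit position table
`w22`. [folklore] -/
theorem sum_K22_diag {τ : C → Matrix (Fin N) (Fin N) ℂ} (hτ : Complete τ) (ho : TrOrthonormal τ) (hN : N ≠ 0)
    (i j k l : Fin 4) (c d : C) :
    ∑ a, K22 rntr (gen τ) i j k l a a c d = if c = d then w22 N i j k l else 0 := by
  simp only [K22, m22, ← Finset.mul_sum, Finset.sum_add_distrib, sum_pSym_diag hτ ho hN]
  unfold w22
  by_cases hij : i < j
  · simp only [if_pos hij, sum_pPair_diag hτ ho hN]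
    split_ifs <;> ring
  · simp only [if_neg hij, Finset.sum_const_zero, add_zero]
    split_ifs <;> ring

end Traced

/-! ## §4 The colour-blind traced form at a background in coordinates -/

section Field

attribute [local instance] Matrix.linftyOpNormedRing Matrix.linftyOpNormedAlgebra

variable {N : ℕ} {C : Type*} [Fintype C] [DecidableEq C]
variable {Λ : Type*} [AddCommGroup Λ] {D : Type*}

/-- **THE COLOUR-BLIND TRACED FORM**: at `B = field (gen τ) u`,
`Σ_a M22 rntr (gen τ) e B x μ ν i j a a = Σ_k Σ_l (Σ_c u_k(c) u_l(c)) · w22 N i j k l` — traced over the fluctuation colour, the `(2,2)`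
vertex sees the background only through the colour inner products of its coordinates at the two background positions. [folklore] -/
theorem sum_M22_field_diag {τ : C → Matrix (Fin N) (Fin N) ℂ} (hτ : Complete τ) (ho : TrOrthonormal τ) (hN : N ≠ 0)
    (e : D → Λ) (u : Λ × (C × D) → ℝ) (x : Λ) (μ ν : D) (i j : Fin 4) :
    ∑ a, M22 rntr (gen τ) e (field (gen τ) u) x μ ν i j a a
      = ∑ k, ∑ l, (∑ c, cv e u x μ ν k c * cv e u x μ ν l c) * w22 N i j k l := by
  simp only [M22_field]
  rw [Finset.sum_comm]
  refine Finset.sum_congr rfl fun k _ => ?_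
  rw [Finset.sum_comm]
  refine Finset.sum_congr rfl fun l _ => ?_
  rw [Finset.sum_comm, Finset.sum_mul]
  refine Finset.sum_congr rfl fun c _ => ?_
  rw [Finset.sum_comm]
  simp only [← Finset.mul_sum, sum_K22_diag hτ ho hN, mul_ite, mul_zero, Finset.sum_ite_eq, Finset.mem_univ, if_true]

/-- THE SUMMED TRACED `(2,2)`-JET at `W`-colour-diagonal data: for every real `σ : Fin 4 → Fin 4 → ℝ` (a position kernel),
`Σ_i Σ_j σ i j Σ_a M22 … i j a a = Σ_i Σ_j Σ_k Σ_l σ i j (u_k · u_l) w22 N i j k l` — the shape of a contraction against a colour-blind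
fluctuation covariance (the covariance itself is NOT in this file). [folklore] -/
theorem sum_sum_M22_field_diag {τ : C → Matrix (Fin N) (Fin N) ℂ} (hτ : Complete τ) (ho : TrOrthonormal τ) (hN : N ≠ 0)
    (e : D → Λ) (u : Λ × (C × D) → ℝ) (x : Λ) (μ ν : D) (σ : Fin 4 → Fin 4 → ℝ) :
    ∑ i, ∑ j, σ i j * ∑ a, M22 rntr (gen τ) e (field (gen τ) u) x μ ν i j a a
      = ∑ i, ∑ j, ∑ k, ∑ l, σ i j * ((∑ c, cv e u x μ ν k c * cv e u x μ ν l c) * w22 N i j k l) := by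
  simp only [sum_M22_field_diag hτ ho hN, Finset.mul_sum]

/-- THE POSITION-DIAGONAL INSTANCE (`σ = 1` on the diagonal): `Σ_i Σ_a M22 … i i a a = (N² − 1) · Σ_k Σ_l (u_k · u_l)(2 qq k l)` — the
`(N² − 1)`-multiple of the scalar-slot (`quadB`) form of the background coordinates. [folklore] -/
theorem sum_M22_field_diag_diag {τ : C → Matrix (Fin N) (Fin N) ℂ} (hτ : Complete τ) (ho : TrOrthonormal τ) (hN : N ≠ 0)
    (e : D → Λ) (u : Λ × (C × D) → ℝ) (x : Λ) (μ ν : D) :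
    ∑ i, ∑ a, M22 rntr (gen τ) e (field (gen τ) u) x μ ν i i a a
      = ((N : ℝ) ^ 2 - 1) * ∑ k, ∑ l, (∑ c, cv e u x μ ν k c * cv e u x μ ν l c) * (2 * qq k l) := by
  simp only [sum_M22_field_diag hτ ho hN]
  rw [Finset.sum_comm, Finset.mul_sum]
  refine Finset.sum_congr rfl fun k _ => ?_
  rw [Finset.sum_comm, Finset.mul_sum]
  refine Finset.sum_congr rfl fun l _ => ?_
  rw [← Finset.mul_sum, sum_w22_diag]
  ring

end Field

/-! ## §5 Examples -/

section Examples

/-- a sample entry: `w22 N 0 1 0 0 = −N²·½ + … `; concretely `w22 N 1 1 0 0 = ¼(N² − 1)` (the contact cell of position `0` seen from the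
fluctuation pair `(1,1)`: only the scalar slot contributes). [folklore] -/
example (N : ℕ) : w22 N 1 1 0 0 = 4⁻¹ * ((N : ℝ) ^ 2 - 1) := by
  simp [w22, wSym, inc, qq, sgn]; ring

/-- the seagull-dominated cell: `w22 N 0 3 0 1 = s_0 s_3 (N²(inc_{30} − inc_{00})(inc_{31} − ½ s_1) + ½(N²−1) qq_{01} + N²(inc_{00} − inc_{30}) s_1)
= −(½N² + ½(N²−1) − N²) = ½`. [folklore] -/
example (N : ℕ) : w22 N 0 3 0 1 = 2⁻¹ := by
  simp [w22, wSym, wPair, inc, qq, sgn, Fin.lt_def]; ring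

/-- at `N = 1` (abelian letters) the scalar-slot part drops out of the position-diagonal contraction. [folklore] -/
example (k l : Fin 4) : ∑ i, w22 1 i i k l = 0 := by
  rw [sum_w22_diag]; simp

end Examples

end Literature.MathematicalPhysics.QuantumFieldTheory.Balaban1983to89.Beta.PlaquetteVertex2Trace
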